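/-
Copyright: lit-balaban Phase-2 proof seat p29 (gen 30).  Statement-level skeleton of a published paper; no proof claims beyond what the
kernel checks below.
-/
import Literature.MathematicalPhysics.QuantumFieldTheory.BalabanImbrieJaffe1984to88.BIJ88LocHolder231TorusOfInputs
import Literature.MathematicalPhysics.QuantumFieldTheory.BalabanImbrieJaffe1984to88.BIJ88NeumannPropagatorSmallFieldCloseCubeTorus
import Literature.MathematicalPhysics.QuantumFieldTheory.BalabanImbrieJaffe1984to88.BIJ85ScalarPropagatorSupDecayDeriv

/-!
# `BalabanImbrieJaffe1984to88.BIJ88LocDeriv231SmallPlaquetteTorus` — T. Bałaban, J. Imbrie, A. Jaffe, *Effective action and cluster properties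
of the abelian Higgs model*, Commun. Math. Phys. **114** (1988) 257–315 [BalabanImbrieJaffe1988], Sect. 2 p. 263 [PDF 7], the sentence after
(2.33): *"Bounds analogous to (2.30), (2.31) hold for covariant derivatives and Hölder derivatives of G_{k,loc}(u) of order less than two"* —
**THE COVARIANT-DERIVATIVE ANALOGUE AND (v1.1) THE HÖLDER MEMBER OF ORDER `θ ≤ 1` OF (2.31) WITH `Ω = T_η`, PRINTED TORUS DATA OF RECORD,
AT A GENERAL SMALL-PLAQUETTE NON-FLAT `U(1)` FIELD, HYPOTHESIS-FREE**: this gen's hypothesis-form members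
`BIJ88LocDeriv231TorusOfInputs.deriv231_wholeTorus_of_inputs` and `BIJ88LocHolder231TorusOfInputs.holder231_wholeTorus_of_inputs` with their
four [6]-inputs DISCHARGED at plaquette-small `u` (`|u(∂p) − 1| ≤ θ` at every fine plaquette, `(L^{2k}θ)² ≤ 1/500`; no gauge condition, no regular
representative — [BalabanImbrieJaffe1985] p. 326 *"The propagators arising from Δ_k(u_k) under the restriction (7.3.1) … also satisfy the
regularity and decay estimates of [7]"*) by the providers of record: p30 gen 28's hypothesis-free torus-cube instances
`close112_smallPlaquette_cube_torus_deriv` / `close112_smallPlaquette_cube_torus` ((1.11)–(1.12), covariant derivative / values; themselves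
built on p30's `close112_smallField_deriv_of_inputs` / `close112_smallField_of_inputs`, p34's and p27's cube members), p30 gen 25's
`decay110_smallField_deriv` and p27's `decay110_smallField_input` ((1.10), covariant derivative / values, whole torus).

statement-level skeleton of published theorems with citation tags; proofs where landed; nothing here is a claim about the Yang–Mills mass gap

PDF held: `paper:balaban1988-cmp114-bij-abelian-higgs-effective-action` (journal page = PDF page + 256); p. 263 [PDF 7] re-read this session.

CITATION HEADER (lean-in-tree rule).  Part of the lit-balaban TYPED SKELETON (HOME `run/shared/lean/pub/lit-balaban/`), PHASE-2 proof seat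
p29 gen 30 (unit `lit-balaban-p29-g30`; TAKING #3/#4 lines HOME/STATUS.md 2026-08-23 — own lineage; p30 gen 28 2026-08-23T06:33Z *"@p29 g30:
instantiate at small u whichever way you prefer — I do not take the (2.31)-D instance"*; free-target protocol G.5-34(d)).  Rows **C2.Claim@263**
/ **C2.Eq2.31** (owner r18; heads unchanged — LOCATED member) and **C1.Eq7.3.1-7.3.2** (owner r15: a located consequence of the p. 326
sentence).  Kind: theorems only (no definition, no `Prop`-valued fact; every provider BY NAME).

THE PRINTED TEXT (p. 263, verbatim, print order).  *"|(G_{k,loc}(u)f − G_k(Ω,u)f)(x)| ≦ e^{−cr(e_k)}e^{−c dist(suppt f,x)}‖f‖_∞, (2.31) for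
dist(x, Ω^c) ≧ O(r(e_k)). … We assume that u is smooth in the □_α's entering the sum in (2.27); for (2.31) we assume smoothness throughout the
subset Ω ⊂ T_η. … Bounds analogous to (2.30), (2.31) hold for covariant derivatives and Hölder derivatives of G_{k,loc}(u) of order less than
two."*

THE MECHANISM (declared).  §1 packages the four inputs at ONE pair of constants `(c₀, δ₀)` depending on `(d, ℓ, a)` only: the four
providers' constants are aligned by monotonicity (`max` of constants, `min` of rates); the input depth is `ρ = 14L^k` (p30 gen 28's row
condition; the value instance's `10L^k` follows); the torus covariant-derivative member is stated with `|·|_∞ = supDist`, converted by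
`T_eq_supDist`; the threshold `(L^{2k}θ)² ≤ 1/500` gives the torus providers' `2d′³(L^{2k}θ)² ≤ 1` for `d′ ≤ 3` (54/500 ≤ 1).
§2 = `deriv231_wholeTorus_of_inputs` ∘ §1; §3 = `holder231_wholeTorus_of_inputs` /
`exists_contour_holder231_wholeTorus_of_inputs` ∘ §1 (v1.1).

WHAT IS PROVED (theorems only; 0 `sorry`; standard axioms).
* §1 **`inputs_smallPlaquette_deriv`** — for `1 ≤ d`, `d + 1 ≤ 3`, `ℓ ≥ 1` with `ℓ + 1` odd, `a > 0` THERE ARE `δ₀, c₀ > 0` such that on every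
  torus of the series (`P.d = d+1`, `P.L = ℓ+1`), at every level `1 ≤ k ≤ K` with `2(L^k − 1) + 4 < |T^{(0)}|`, for every `U(1)` field with
  `|u(∂p) − 1| ≤ θ`, `0 ≤ θ`, `(L^{2k}θ)² ≤ 1/500`: the hypotheses (H1)–(H4) of `deriv231_wholeTorus_of_inputs` HOLD with `ρ = 14L^k`.
* §2 **`deriv231_smallPlaquette_torus`** — THERE ARE `δ₀, C > 0` depending on `(d, ℓ, a)` only such that, for the same tori, levels and
  fields, for the printed data (no-wrap box `Ω₀` shorter than the torus with torus gap `≥ R`,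
  `s ≥ 1`, `W ≥ 2s/3 + R₀/2 + R`, `R > 14L^k + 1`, `0 ≤ R₁ < R₀`, cut-off `cutoff R₁ R₀ |·|_T`), every bond `⟨x, x+e_μ⟩` with both ends in `Ω₀`
  at chart depth `≥ R₀ + R` and every `f` (`‖f‖_∞ ≤ F`) supported at sup-torus distance `≥ D ≥ 0` from `x`:
  `‖D_u(G_{k,loc}(u)f)(x,μ) − D_u(G_k(T_η,u)f)(x,μ)‖ ≤ (L^kε)·C·[m(1 + L^k((R₀−R₁)⁻¹ + s⁻¹))e^{−δ₀(2R−1)/L^k} + (1 + L^k(R₀−R₁)⁻¹)e^{−(δ₀/2)(R₁−1)/L^k}]·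
  e^{−(δ₀/2)D/L^k}·F`.
* §3 (v1.1) **`holder231_smallPlaquette_torus`** / **`exists_contour_holder231_smallPlaquette_torus`** — the HÖLDER MEMBER OF ORDER `θ' ≤ 1`
  of (2.31) at the same fields and data: for every `0 ≤ θ' ≤ 1`, every pair `x₁, x₂` joined by an admissible bond chain `Γ` (sites in `Ω₀` at
  chart depth `≥ R₀ + R`, `≤ (d+1)|x₁ − x₂|_T` steps; the chart staircase is one for `|x₁ − x₂|_T ≤ R₀ + R`), every `f` supported at distance
  `≥ D` from both points, `ψ = G_{k,loc}(u)f − G_k(T_η,u)f`: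
  `(L^k/|x₁ − x₂|_T)^{θ'}·‖u(Γ)ψ(x₂) − ψ(x₁)‖ ≤ (L^kε)²·C·e^{δ₀/2}·[the bracket of §2]·e^{−(δ₀/2)D/L^k}·F`.
HONEST SCOPE / DIVERGENCE.  (i) `2 ≤ d + 1 ≤ 3` space-time dimensions and `L = ℓ + 1` odd `≥ 3` (the providers' scope: p30's interior
gradient estimate needs `d + 1 ≥ 2`, the cube reflection needs `L` odd).  (ii) Plaquette smallness at the BLOCK scale `(L^{2k}θ)² ≤ 1/500`
(p31's threshold of record), not print's `p(e_k)`; the field is otherwise arbitrary (no axial/Landau gauge, no smooth representative (2.32)).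
(iii) `Ω = T_η`; deep bonds only (`R > 14L^k + 1`, chart depth `≥ R₀ + R`).  (iv) METHOD DIVERGENCE inherited from the providers (p30's
(1.11)–(1.12) members are proved by a maximum principle / local gradient estimate, not by print's random-walk expansion — disclosed in their
files).  (v) Constants not optimized.  Imports: this gen's `BIJ88LocHolder231TorusOfInputs` (→ `BIJ88LocDeriv231TorusOfInputs`); p30's
`BIJ88NeumannPropagatorSmallFieldCloseCubeTorus`
(→ `…CloseDeriv` → `…Close`, p34's / p27's cube members), p30's `BIJ85ScalarPropagatorSupDecayDeriv`.  Literature + Mathlib only.  Unit `lit-balaban-p29`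
(literature-prover-lit-balaban-p29-g30-0), 2026-08-23.  v1.1 = v1 + §3 (and the import of `BIJ88LocHolder231TorusOfInputs`); §§1–2 byte-identical.
NOT summit progress.
-/

open scoped BigOperators Matrix ComplexConjugate
open Finset Matrix

namespace Literature.MathematicalPhysics.QuantumFieldTheory.BalabanImbrieJaffe1984to88.BIJ88LocDeriv231SmallPlaquetteTorus

open Literature.MathematicalPhysics.QuantumFieldTheory.Balaban1983to89
open BIJ88Sect3Statements (U1 toC cfg covD)
open BIJ85BlockAveragesTorus BIJ85BlockAveragesTorusK
open BIJ88NeumannPropagator227Torus (gBox)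
open BIJ88DeltaLoc234Torus (gLocT)
open BIJ88NeumannPropagatorFlatDecayCube (cubeT boxCoord)
open BIJ88Cutoffs21 (cutoff)
open BIJ88LocWeights227Torus
open BIJ85AbelianStokes (plaqC)
open BIJ88NeumannPropagatorSmallFieldCloseCubeTorus (close112_smallPlaquette_cube_torus close112_smallPlaquette_cube_torus_deriv)
open BIJ85ScalarPropagatorSupDecay (decay110_smallField_input)
open BIJ85ScalarPropagatorSupDecayDeriv (decay110_smallField_deriv)
open BIJ88LocDeriv231TorusOfInputs (deriv231_wholeTorus_of_inputs)
open BIJ88LocHolder231TorusOfInputs (holder231_wholeTorus_of_inputs exists_contour_holder231_wholeTorus_of_inputs)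
open T4TreeGaugeFixing (Joins)
open T4TreeGaugeTransform (chainHol)
open B3Bound323ZeroTorus (T_eq_supDist)
open LatticeFieldCalculus (supDist)

noncomputable section

variable {d : ℕ} {P : Params}

/-! ## §1 The four [6]-inputs at small plaquette fields, at one pair of constants -/

/-- kernel: `e^{−δ'E} ≤ e^{−δE}` for `δ ≤ δ'`, `E ≥ 0`. [folklore] -/
private theorem exp_le_exp_of_rate {δ δ' E : ℝ} (hδ : δ ≤ δ') (hE : 0 ≤ E) : Real.exp (-(δ' * E)) ≤ Real.exp (-(δ * E)) :=
  Real.exp_le_exp.2 (neg_le_neg (mul_le_mul_of_nonneg_right hδ hE))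

/-- kernel: monotonicity of a bound `c·e^{−δE}·F` in the constant and the rate. [folklore] -/
private theorem bound_mono {c C δ Δ E F : ℝ} (hc : 0 ≤ c) (hcC : c ≤ C) (hΔ : Δ ≤ δ) (hE : 0 ≤ E) (hF : 0 ≤ F) :
    c * Real.exp (-(δ * E)) * F ≤ C * Real.exp (-(Δ * E)) * F :=
  mul_le_mul_of_nonneg_right (mul_le_mul hcC (exp_le_exp_of_rate hΔ hE) (Real.exp_pos _).le (hc.trans hcC)) hF

/-- kernel: the same with the (1.12) bracket. [folklore] -/
private theorem bound_mono₂ {c C δ Δ E E' F : ℝ} (hc : 0 ≤ c) (hcC : c ≤ C) (hΔ : Δ ≤ δ) (hE : 0 ≤ E) (hE' : 0 ≤ E') (hF : 0 ≤ F) :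
    c * Real.exp (-(δ * E)) * Real.exp (-(δ * E')) * F ≤ C * Real.exp (-(Δ * E)) * Real.exp (-(Δ * E')) * F :=
  mul_le_mul_of_nonneg_right (mul_le_mul (mul_le_mul hcC (exp_le_exp_of_rate hΔ hE) (Real.exp_pos _).le (hc.trans hcC))
    (exp_le_exp_of_rate hΔ hE') (Real.exp_pos _).le (mul_nonneg (hc.trans hcC) (Real.exp_pos _).le)) hF

set_option maxHeartbeats 400000 in
/-- **THE FOUR [6]-INPUTS OF `deriv231_wholeTorus_of_inputs` AT SMALL PLAQUETTE FIELDS, AT ONE PAIR OF CONSTANTS** ([BalabanImbrieJaffe1985]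
p. 326: *"The propagators arising from Δ_k(u_k) under the restriction (7.3.1) … also satisfy the regularity and decay estimates of [7]"*; [6] =
[Balaban1983RegularityDecay] Theorem p. 573 (1.10)–(1.12)): for `1 ≤ d`, `d + 1 ≤ 3`, `ℓ ≥ 1`, `ℓ + 1` odd, `a > 0`, THERE ARE `δ₀, c₀ > 0`
depending on `(d, ℓ, a)` only such that on every torus (`P.d = d+1`, `P.L = ℓ+1`), at every `1 ≤ k ≤ K` with
`2(L^k−1) + 4 < |T^{(0)}|`, for every field with `|u(∂p) − 1| ≤ θ`, `0 ≤ θ`, `(L^{2k}θ)² ≤ 1/500`: (H1) the (1.11)–(1.12) covariant-derivative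
closeness for every fitting no-wrap cube at its `14L^k`-deep rows (p30 gen 28's `close112_smallPlaquette_cube_torus_deriv`), (H2) the value
closeness there (`close112_smallPlaquette_cube_torus`, rows `10L^k ≤ 14L^k`), (H3)/(H4) the (1.10) covariant-derivative / value members of
`G_k(T_η,u)` at every row (p30 gen 25 `decay110_smallField_deriv` / p27 `decay110_smallField_input`) — all four at `(c₀, δ₀)`, in the binder
shapes of `deriv231_wholeTorus_of_inputs` with `ρ = 14L^k`.
[cite: BalabanImbrieJaffe1985, (7.3.1) p.326] [cite: Balaban1983RegularityDecay, Theorem p.573 (1.10)–(1.12)] [cite: BalabanImbrieJaffe1988, (2.31) p.263] -/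
theorem inputs_smallPlaquette_deriv (d ℓ : ℕ) (hd1 : 1 ≤ d) (hd3 : d + 1 ≤ 3) (hℓ : 1 ≤ ℓ) (hodd : Odd (ℓ + 1)) {a : ℝ} (ha : 0 < a) :
    ∃ δ₀ c₀ : ℝ, 0 < δ₀ ∧ 0 < c₀ ∧ ∀ (P : Params) (hPd : P.d = d + 1), P.L = ℓ + 1 →
      ∀ (k : ℕ), 1 ≤ k → k ≤ P.K → 2 * (P.L ^ k - 1) + 4 < P.sitesPerDir 0 →
      ∀ (U : GaugeField P 0 U1) (θ : ℝ), 0 ≤ θ → (∀ (y : Balaban1983to89.Site P 0) (μ ν : Fin P.d), ‖plaqC U y μ ν - 1‖ ≤ θ) →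
        (((P.L : ℝ) ^ k) ^ 2 * θ) ^ 2 ≤ 1 / 500 →
      (∀ (c' M' : Fin (d + 1) → ℕ), (∀ i, 1 ≤ M' i) → (∀ i, c' i * P.L ^ k + P.L ^ k * M' i ≤ P.sitesPerDir 0) →
          (∀ i, P.L ^ k * M' i < P.sitesPerDir 0) →
        ∀ (x : Balaban1983to89.Site P 0) (μ : Fin P.d), x ∈ (cubeT hPd (P.L ^ k) c' fun i => P.L ^ k * M' i) →
          x.shift μ ∈ (cubeT hPd (P.L ^ k) c' fun i => P.L ^ k * M' i) →
          (∀ w, w ∉ (cubeT hPd (P.L ^ k) c' fun i => P.L ^ k * M' i) → 14 * (P.L : ℝ) ^ k ≤ B5Ineq137Torus.T P 0 x w) →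
        ∀ (g : Balaban1983to89.Site P 0 → ℂ) (F D Db Df : ℝ), (∀ y, ‖g y‖ ≤ F) →
          (∀ y, y ∉ (cubeT hPd (P.L ^ k) c' fun i => P.L ^ k * M' i) → g y = 0) →
          0 ≤ D → (∀ y, g y ≠ 0 → D ≤ B5Ineq137Torus.T P 0 x y) →
          0 ≤ Db → (∀ w, w ∉ (cubeT hPd (P.L ^ k) c' fun i => P.L ^ k * M' i) → Db ≤ B5Ineq137Torus.T P 0 x w) →
          0 ≤ Df → (∀ y, g y ≠ 0 → ∀ w, w ∉ (cubeT hPd (P.L ^ k) c' fun i => P.L ^ k * M' i) → Df ≤ B5Ineq137Torus.T P 0 y w) →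
          ‖covD P.eps⁻¹ (cfg U) (gBox (B1RG242Torus.α P a k * (P.L : ℝ) ^ (k * P.d)) P.eps⁻¹ U k
                  (cubeT hPd (P.L ^ k) c' fun i => P.L ^ k * M' i) *ᵥ g) ⟨x, μ⟩ -
              covD P.eps⁻¹ (cfg U) (gBox (B1RG242Torus.α P a k * (P.L : ℝ) ^ (k * P.d)) P.eps⁻¹ U k univ *ᵥ g) ⟨x, μ⟩‖ ≤
            P.spacing k * (c₀ * Real.exp (-(δ₀ * (((P.L : ℝ) ^ k)⁻¹ * D))) * Real.exp (-(δ₀ * (((P.L : ℝ) ^ k)⁻¹ * (Db + Df)))) * F)) ∧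
      (∀ (c' M' : Fin (d + 1) → ℕ), (∀ i, 1 ≤ M' i) → (∀ i, c' i * P.L ^ k + P.L ^ k * M' i ≤ P.sitesPerDir 0) →
          (∀ i, P.L ^ k * M' i < P.sitesPerDir 0) →
        ∀ (x : Balaban1983to89.Site P 0), x ∈ (cubeT hPd (P.L ^ k) c' fun i => P.L ^ k * M' i) →
          (∀ w, w ∉ (cubeT hPd (P.L ^ k) c' fun i => P.L ^ k * M' i) → 14 * (P.L : ℝ) ^ k ≤ B5Ineq137Torus.T P 0 x w) →
        ∀ (g : Balaban1983to89.Site P 0 → ℂ) (F D Db Df : ℝ), (∀ y, ‖g y‖ ≤ F) →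
          (∀ y, y ∉ (cubeT hPd (P.L ^ k) c' fun i => P.L ^ k * M' i) → g y = 0) →
          0 ≤ D → (∀ y, g y ≠ 0 → D ≤ B5Ineq137Torus.T P 0 x y) →
          0 ≤ Db → (∀ w, w ∉ (cubeT hPd (P.L ^ k) c' fun i => P.L ^ k * M' i) → Db ≤ B5Ineq137Torus.T P 0 x w) →
          0 ≤ Df → (∀ y, g y ≠ 0 → ∀ w, w ∉ (cubeT hPd (P.L ^ k) c' fun i => P.L ^ k * M' i) → Df ≤ B5Ineq137Torus.T P 0 y w) →
          ‖(gBox (B1RG242Torus.α P a k * (P.L : ℝ) ^ (k * P.d)) P.eps⁻¹ U k (cubeT hPd (P.L ^ k) c' fun i => P.L ^ k * M' i) *ᵥ g) x -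
              (gBox (B1RG242Torus.α P a k * (P.L : ℝ) ^ (k * P.d)) P.eps⁻¹ U k univ *ᵥ g) x‖ ≤
            P.spacing k ^ 2 * (c₀ * Real.exp (-(δ₀ * (((P.L : ℝ) ^ k)⁻¹ * D))) * Real.exp (-(δ₀ * (((P.L : ℝ) ^ k)⁻¹ * (Db + Df)))) * F)) ∧
      (∀ (x : Balaban1983to89.Site P 0) (μ : Fin P.d) (g : Balaban1983to89.Site P 0 → ℂ) (F D : ℝ), (∀ y, ‖g y‖ ≤ F) → 0 ≤ D →
          (∀ y, g y ≠ 0 → D ≤ B5Ineq137Torus.T P 0 x y) →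
          ‖covD P.eps⁻¹ (cfg U) (gBox (B1RG242Torus.α P a k * (P.L : ℝ) ^ (k * P.d)) P.eps⁻¹ U k univ *ᵥ g) ⟨x, μ⟩‖ ≤
            P.spacing k * (c₀ * Real.exp (-(δ₀ * (((P.L : ℝ) ^ k)⁻¹ * D))) * F)) ∧
      (∀ (x : Balaban1983to89.Site P 0) (g : Balaban1983to89.Site P 0 → ℂ) (F D : ℝ), (∀ y, ‖g y‖ ≤ F) → 0 ≤ D →
          (∀ y, g y ≠ 0 → D ≤ B5Ineq137Torus.T P 0 x y) →
          ‖(gBox (B1RG242Torus.α P a k * (P.L : ℝ) ^ (k * P.d)) P.eps⁻¹ U k univ *ᵥ g) x‖ ≤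
            P.spacing k ^ 2 * (c₀ * Real.exp (-(δ₀ * (((P.L : ℝ) ^ k)⁻¹ * D))) * F)) := by
  have hL : Odd (ℓ + 1) ∧ 1 < ℓ + 1 := ⟨hodd, by omega⟩
  -- the four providers
  obtain ⟨c₁, δ₁, hc₁, hδ₁, H1p⟩ := close112_smallPlaquette_cube_torus_deriv d ℓ hd1 hd3 hℓ hodd ha
  obtain ⟨c₂, δ₂, hc₂, hδ₂, H2p⟩ := close112_smallPlaquette_cube_torus d ℓ hd1 hd3 hℓ hodd ha
  obtain ⟨td, cd, htd, hcd, H3p⟩ := decay110_smallField_deriv (d + 1) (ℓ + 1) (by omega) hd3 hL ha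
  obtain ⟨δa, ca, hδa, hca, H4p⟩ := decay110_smallField_input (d + 1) (ℓ + 1) (Nat.succ_pos d) hd3 hL ha
  -- the common constants
  set δ₀ : ℝ := min (min δ₁ δ₂) (min td δa) with hδ₀def
  set c₀ : ℝ := max (max c₁ c₂) (max cd ca) with hc₀def
  have hδ₀ : 0 < δ₀ := lt_min (lt_min hδ₁ hδ₂) (lt_min htd hδa)
  have hc₀ : 0 < c₀ := lt_max_of_lt_left (lt_max_of_lt_left hc₁)
  have hc1_0 : c₁ ≤ c₀ := (le_max_left _ _).trans (le_max_left _ _)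
  have hc2_0 : c₂ ≤ c₀ := (le_max_right _ _).trans (le_max_left _ _)
  have hcd_0 : cd ≤ c₀ := (le_max_left _ _).trans (le_max_right _ _)
  have hca_0 : ca ≤ c₀ := (le_max_right _ _).trans (le_max_right _ _)
  have hδ1_0 : δ₀ ≤ δ₁ := (min_le_left _ _).trans (min_le_left _ _)
  have hδ2_0 : δ₀ ≤ δ₂ := (min_le_left _ _).trans (min_le_right _ _)
  have htd_0 : δ₀ ≤ td := (min_le_right _ _).trans (min_le_left _ _)
  have hδa_0 : δ₀ ≤ δa := (min_le_right _ _).trans (min_le_right _ _)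
  refine ⟨δ₀, c₀, hδ₀, hc₀, ?_⟩
  intro P hPd hPL k hk1 hkK hbig U θ hθ0 hθ hτ
  have hPk : (0 : ℝ) < (P.L : ℝ) ^ k := pow_pos P.cast_L_pos k
  have hPkinv : 0 ≤ ((P.L : ℝ) ^ k)⁻¹ := (inv_pos.2 hPk).le
  have hsk : 0 < P.spacing k := P.spacing_pos k
  have hsk2 : 0 ≤ P.spacing k ^ 2 := sq_nonneg _
  -- the torus providers' smallness `2d′³(L^{2k}θ)² ≤ 1` from the threshold (`d′ ≤ 3`: `54/500 ≤ 1`)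
  have hsm1 : 2 * (P.d : ℝ) ^ 3 * (((P.L : ℝ) ^ k) ^ 2 * θ) ^ 2 ≤ 1 := by
    have hd3r : (P.d : ℝ) ≤ 3 := by rw [hPd]; exact_mod_cast hd3
    have hd27 : (P.d : ℝ) ^ 3 ≤ 27 := by
      have h := pow_le_pow_left₀ (Nat.cast_nonneg P.d) hd3r 3
      norm_num at h
      exact h
    have h1 : 2 * (P.d : ℝ) ^ 3 * (((P.L : ℝ) ^ k) ^ 2 * θ) ^ 2 ≤ 2 * 27 * (1 / 500) :=
      mul_le_mul (mul_le_mul_of_nonneg_left hd27 (by norm_num)) hτ (sq_nonneg _) (by norm_num)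
    linarith
  set A : ℝ := B1RG242Torus.α P a k * (P.L : ℝ) ^ (k * P.d) with hAdef
  refine ⟨?_, ?_, ?_, ?_⟩
  · -- (H1): p30 gen 28's torus-cube covariant-derivative instance, rows `14L^k`-deep
    intro c' M' hM' hfit' hN' x μ hx _ hρx g F D Db Df hF hsuppg hD hsD hDb hsDb hDf hsDf
    have hF0 : 0 ≤ F := (norm_nonneg _).trans (hF x)
    exact (H1p P hPd hPL k hk1 hkK hbig U θ hθ0 hθ hτ c' M' hM' hfit' hN' x hx hρx g F D Db Df hF hsuppg hD hsD hDb hsDb hDf hsDf μ).trans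
      (mul_le_mul_of_nonneg_left
        (bound_mono₂ hc₁.le hc1_0 hδ1_0 (mul_nonneg hPkinv hD) (mul_nonneg hPkinv (add_nonneg hDb hDf)) hF0) hsk.le)
  · -- (H2): the torus-cube value instance, rows `14L^k ≥ 10L^k`-deep
    intro c' M' hM' hfit' hN' x hx hρx g F D Db Df hF hsuppg hD hsD hDb hsDb hDf hsDf
    have hF0 : 0 ≤ F := (norm_nonneg _).trans (hF x)
    have hρx' : ∀ w, w ∉ (cubeT hPd (P.L ^ k) c' fun i => P.L ^ k * M' i) → 10 * (P.L : ℝ) ^ k ≤ B5Ineq137Torus.T P 0 x w :=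
      fun w hw => le_trans (by nlinarith [hPk]) (hρx w hw)
    exact (H2p P hPd hPL k hk1 hkK hbig U θ hθ0 hθ hτ c' M' hM' hfit' hN' x hx hρx' g F D Db Df hF hsuppg hD hsD hDb hsDb hDf hsDf).trans
      (mul_le_mul_of_nonneg_left
        (bound_mono₂ hc₂.le hc2_0 hδ2_0 (mul_nonneg hPkinv hD) (mul_nonneg hPkinv (add_nonneg hDb hDf)) hF0) hsk2)
  · -- (H3): the (1.10) covariant-derivative member of `G_k(T_η,u)` (p30 gen 25; `supDist` rows)
    intro x μ g F D hF hD hsupp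
    have hF0 : 0 ≤ F := (norm_nonneg _).trans (hF x)
    have hsupp' : ∀ z, g z ≠ 0 → D ≤ (supDist x z : ℝ) := fun z hz => by rw [← T_eq_supDist P]; exact hsupp z hz
    have h := H3p P hPd hPL k hk1 hkK U θ hθ hsm1 x μ g F D hF hsupp'
    have e : td * D / (P.L : ℝ) ^ k = td * (((P.L : ℝ) ^ k)⁻¹ * D) := by rw [div_eq_mul_inv]; ring
    rw [e] at h
    calc _ ≤ cd * P.spacing k * Real.exp (-(td * (((P.L : ℝ) ^ k)⁻¹ * D))) * F := h
      _ = P.spacing k * (cd * Real.exp (-(td * (((P.L : ℝ) ^ k)⁻¹ * D))) * F) := by ring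
      _ ≤ P.spacing k * (c₀ * Real.exp (-(δ₀ * (((P.L : ℝ) ^ k)⁻¹ * D))) * F) :=
          mul_le_mul_of_nonneg_left (bound_mono hcd.le hcd_0 htd_0 (mul_nonneg hPkinv hD) hF0) hsk.le
  · -- (H4): the (1.10) value member of `G_k(T_η,u)` (p27)
    intro x g F D hF hD hsupp
    have hF0 : 0 ≤ F := (norm_nonneg _).trans (hF x)
    exact (H4p P hPd hPL k hk1 hkK U θ hθ hsm1 x g F D hF hsupp).trans
      (mul_le_mul_of_nonneg_left (bound_mono hca.le hca_0 hδa_0 (mul_nonneg hPkinv hD) hF0) hsk2)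

/-! ## §2 The covariant-derivative analogue of (2.31), `Ω = T_η`, at small plaquette fields — hypothesis-free -/

set_option maxHeartbeats 400000 in
/-- **THE COVARIANT-DERIVATIVE ANALOGUE OF (2.31) WITH `Ω = T_η` FOR THE PRINTED LOCALIZATION DATA AT A GENERAL SMALL-PLAQUETTE `U(1)`
FIELD** (p. 263: *"Bounds analogous to (2.30), (2.31) hold for covariant derivatives and Hölder derivatives of G_{k,loc}(u) of order less than
two"*; [BalabanImbrieJaffe1985] p. 326 (7.3.1)).  For `1 ≤ d`, `d + 1 ≤ 3`, `ℓ ≥ 1`, `ℓ + 1` odd, `a > 0` THERE ARE `δ₀, C > 0` depending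
on `(d, ℓ, a)` only such that on every torus
(`P.d = d+1`, `P.L = ℓ+1`), at every `1 ≤ k ≤ K` with `2(L^k−1) + 4 < |T^{(0)}|`, for every field with `|u(∂p) − 1| ≤ θ`, `0 ≤ θ`,
`(L^{2k}θ)² ≤ 1/500`, for the printed data (torus gap `≥ R > 14L^k + 1`, `s ≥ 1`, `W ≥ 2s/3 + R₀/2 + R`, `0 ≤ R₁ < R₀`, cut-off
`cutoff R₁ R₀ |·|_T`), every bond `⟨x, x+e_μ⟩` with both ends in `Ω₀` at chart depth `≥ R₀ + R` and every `f` (`‖f‖_∞ ≤ F`) supported at sup-torus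
distance `≥ D ≥ 0` from `x`:
`‖D_u(G_{k,loc}(u)f)(x,μ) − D_u(G_k(T_η,u)f)(x,μ)‖ ≤ (L^kε)·C·[m(1 + L^k((R₀−R₁)⁻¹ + s⁻¹))e^{−δ₀(2R−1)/L^k} + (1 + L^k(R₀−R₁)⁻¹)e^{−(δ₀/2)(R₁−1)/L^k}]·
e^{−(δ₀/2)D/L^k}·F` — `deriv231_wholeTorus_of_inputs` ∘ `inputs_smallPlaquette_deriv`.
[cite: BalabanImbrieJaffe1988, (2.31) p.263] [cite: BalabanImbrieJaffe1985, (7.3.1) p.326] -/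
theorem deriv231_smallPlaquette_torus (d ℓ : ℕ) (hd1 : 1 ≤ d) (hd3 : d + 1 ≤ 3) (hℓ : 1 ≤ ℓ) (hodd : Odd (ℓ + 1)) {a : ℝ} (ha : 0 < a) :
    ∃ δ₀ C : ℝ, 0 < δ₀ ∧ 0 < C ∧ ∀ (P : Params) (hPd : P.d = d + 1), P.L = ℓ + 1 →
      ∀ (k : ℕ), 1 ≤ k → k ≤ P.K → 2 * (P.L ^ k - 1) + 4 < P.sitesPerDir 0 →
      ∀ (U : GaugeField P 0 U1) (θ : ℝ), 0 ≤ θ → (∀ (y : Balaban1983to89.Site P 0) (μ ν : Fin P.d), ‖plaqC U y μ ν - 1‖ ≤ θ) →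
        (((P.L : ℝ) ^ k) ^ 2 * θ) ^ 2 ≤ 1 / 500 →
      ∀ (c M0 : Fin (d + 1) → ℕ), (∀ i, 1 ≤ M0 i) →
        (∀ i, c i * P.L ^ k + P.L ^ k * M0 i ≤ P.sitesPerDir 0) → (∀ i, P.L ^ k * M0 i < P.sitesPerDir 0) →
      ∀ (s W : ℕ), 1 ≤ s → ∀ (R R₀ R₁ : ℝ), 14 * (P.L : ℝ) ^ k + 1 < R → 0 ≤ R₁ → R₁ < R₀ → 2 * (s : ℝ) / 3 + R₀ / 2 + R ≤ W →
        (∀ i, ((P.L ^ k * M0 i : ℕ) : ℝ) + R ≤ P.sitesPerDir 0) →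
      ∀ (x : Balaban1983to89.Site P 0) (μ : Fin P.d),
        x ∈ (cubeT hPd (P.L ^ k) c fun i => P.L ^ k * M0 i) →
        (∀ i, R₀ + R ≤ (boxCoord hPd (P.L ^ k) c x i : ℝ) ∧ (boxCoord hPd (P.L ^ k) c x i : ℝ) + (R₀ + R) ≤ (P.L ^ k * M0 i : ℕ) - 1) →
        x.shift μ ∈ (cubeT hPd (P.L ^ k) c fun i => P.L ^ k * M0 i) →
        (∀ i, R₀ + R ≤ (boxCoord hPd (P.L ^ k) c (x.shift μ) i : ℝ) ∧
          (boxCoord hPd (P.L ^ k) c (x.shift μ) i : ℝ) + (R₀ + R) ≤ (P.L ^ k * M0 i : ℕ) - 1) →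
      ∀ (f : Balaban1983to89.Site P 0 → ℂ) (F D : ℝ), (∀ y, ‖f y‖ ≤ F) → 0 ≤ D → (∀ y, f y ≠ 0 → D ≤ B5Ineq137Torus.T P 0 x y) →
        ‖covD P.eps⁻¹ (cfg U)
              (gLocT (B1RG242Torus.α P a k * (P.L : ℝ) ^ (k * P.d)) P.eps⁻¹ U k
                (cubeFam hPd (P.L ^ k) c M0 s W) (lamFam hPd (P.L ^ k) c M0 s) (cutoff R₁ R₀ (B5Ineq137Torus.T P 0)) *ᵥ f) ⟨x, μ⟩ -
            covD P.eps⁻¹ (cfg U) (gBox (B1RG242Torus.α P a k * (P.L : ℝ) ^ (k * P.d)) P.eps⁻¹ U k univ *ᵥ f) ⟨x, μ⟩‖ ≤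
          P.spacing k * (C * ((⌊(((P.L : ℝ) ^ k) - 1 + R₀) / s⌋₊ + 3) ^ (d + 1) * (1 + (P.L : ℝ) ^ k * ((R₀ - R₁)⁻¹ + (s : ℝ)⁻¹)) *
              Real.exp (-(δ₀ * (((P.L : ℝ) ^ k)⁻¹ * (2 * R - 1)))) +
            (1 + (P.L : ℝ) ^ k * (R₀ - R₁)⁻¹) * Real.exp (-(δ₀ / 2 * (((P.L : ℝ) ^ k)⁻¹ * (R₁ - 1))))) *
            Real.exp (-(δ₀ / 2 * (((P.L : ℝ) ^ k)⁻¹ * D))) * F) := by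
  obtain ⟨δ₀, c₀, hδ₀, hc₀, HI⟩ := inputs_smallPlaquette_deriv d ℓ hd1 hd3 hℓ hodd ha
  obtain ⟨C, hC, G⟩ := deriv231_wholeTorus_of_inputs d hc₀.le
  refine ⟨δ₀, C, hδ₀, hC, ?_⟩
  intro P hPd hPL k hk1 hkK hbig U θ hθ0 hθ hτ c M0 hM0 hfit0 hN0 s W hs R R₀ R₁ hR hR₁ hR10 hW hgap x μ hx hdeep hxe hdeepe f F D hF hD hsupp
  obtain ⟨H1, H2, H3, H4⟩ := HI P hPd hPL k hk1 hkK hbig U θ hθ0 hθ hτ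
  exact G P hPd a k hk1 hkK U δ₀ (14 * (P.L : ℝ) ^ k) hδ₀ (by positivity) H1 H2 H3 H4 c M0 hM0 hfit0 hN0 s W hs R R₀ R₁ hR hR₁ hR10 hW
    hgap x μ hx hdeep hxe hdeepe f F D hF hD hsupp

/-! ## §3 The Hölder member of order `θ ≤ 1` of (2.31), `Ω = T_η`, at small plaquette fields — hypothesis-free -/

set_option maxHeartbeats 400000 in
/-- **THE HÖLDER MEMBER OF ORDER `θ ≤ 1` OF (2.31) WITH `Ω = T_η` FOR THE PRINTED LOCALIZATION DATA AT A GENERAL SMALL-PLAQUETTE `U(1)` FIELD,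
ALONG EVERY ADMISSIBLE CONTOUR** (p. 263: *"Bounds analogous to (2.30), (2.31) hold for covariant derivatives and Hölder derivatives of
G_{k,loc}(u) of order less than two"*; [BalabanImbrieJaffe1985] p. 326 (7.3.1)).  For `1 ≤ d`, `d + 1 ≤ 3`, `ℓ ≥ 1`, `ℓ + 1` odd, `a > 0`
THERE ARE `δ₀, C > 0` depending on `(d, ℓ, a)` only such that on every torus (`P.d = d+1`, `P.L = ℓ+1`), at every `1 ≤ k ≤ K` with
`2(L^k−1) + 4 < |T^{(0)}|`, for every field with `|u(∂p) − 1| ≤ θ`, `0 ≤ θ`, `(L^{2k}θ)² ≤ 1/500`, for the printed data (`R > 14L^k + 1`), every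
`0 ≤ θ' ≤ 1`, every pair `x₁, x₂` joined by a bond chain `Γ` of `≤ (d+1)|x₁ − x₂|_T` steps whose sites lie in `Ω₀` at chart depth `≥ R₀ + R`
and within `|x₁ − x₂|_T` of `x₁`, every `f` (`‖f‖_∞ ≤ F`) supported at sup-torus distance `≥ D ≥ 0` from both points, with
`ψ = G_{k,loc}(u)f − G_k(T_η,u)f`:
`(L^k/|x₁ − x₂|_T)^{θ'}·‖u(Γ)ψ(x₂) − ψ(x₁)‖ ≤ (L^kε)²·C·e^{δ₀/2}·[m(1 + L^k((R₀−R₁)⁻¹ + s⁻¹))e^{−δ₀(2R−1)/L^k} + (1 + L^k(R₀−R₁)⁻¹)e^{−(δ₀/2)(R₁−1)/L^k}]·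
e^{−(δ₀/2)D/L^k}·F` — `holder231_wholeTorus_of_inputs` ∘ `inputs_smallPlaquette_deriv`.
[cite: BalabanImbrieJaffe1988, (2.31) p.263] [cite: BalabanImbrieJaffe1985, (7.3.1) p.326] [cite: Balaban1983RegularityDecay, Theorem p.573 (1.9)] -/
theorem holder231_smallPlaquette_torus (d ℓ : ℕ) (hd1 : 1 ≤ d) (hd3 : d + 1 ≤ 3) (hℓ : 1 ≤ ℓ) (hodd : Odd (ℓ + 1)) {a : ℝ} (ha : 0 < a) :
    ∃ δ₀ C : ℝ, 0 < δ₀ ∧ 0 < C ∧ ∀ (P : Params) (hPd : P.d = d + 1), P.L = ℓ + 1 →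
      ∀ (k : ℕ), 1 ≤ k → k ≤ P.K → 2 * (P.L ^ k - 1) + 4 < P.sitesPerDir 0 →
      ∀ (U : GaugeField P 0 U1) (θ : ℝ), 0 ≤ θ → (∀ (y : Balaban1983to89.Site P 0) (μ ν : Fin P.d), ‖plaqC U y μ ν - 1‖ ≤ θ) →
        (((P.L : ℝ) ^ k) ^ 2 * θ) ^ 2 ≤ 1 / 500 →
      ∀ (c M0 : Fin (d + 1) → ℕ), (∀ i, 1 ≤ M0 i) →
        (∀ i, c i * P.L ^ k + P.L ^ k * M0 i ≤ P.sitesPerDir 0) → (∀ i, P.L ^ k * M0 i < P.sitesPerDir 0) →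
      ∀ (s W : ℕ), 1 ≤ s → ∀ (R R₀ R₁ : ℝ), 14 * (P.L : ℝ) ^ k + 1 < R → 0 ≤ R₁ → R₁ < R₀ → 2 * (s : ℝ) / 3 + R₀ / 2 + R ≤ W →
        (∀ i, ((P.L ^ k * M0 i : ℕ) : ℝ) + R ≤ P.sitesPerDir 0) →
      ∀ (θ' : ℝ), 0 ≤ θ' → θ' ≤ 1 →
      ∀ (x₁ x₂ : Balaban1983to89.Site P 0) (n : ℕ) (sq : ℕ → Balaban1983to89.Site P 0) (cb : ℕ → PBond P 0),
        sq 0 = x₁ → sq n = x₂ → (∀ m < n, Joins (cb m) (sq m) (sq (m + 1))) →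
        (n : ℝ) ≤ ((d : ℝ) + 1) * B5Ineq137Torus.T P 0 x₁ x₂ →
        (∀ m ≤ n, sq m ∈ (cubeT hPd (P.L ^ k) c fun i => P.L ^ k * M0 i) ∧
          (∀ i, R₀ + R ≤ (boxCoord hPd (P.L ^ k) c (sq m) i : ℝ) ∧
            (boxCoord hPd (P.L ^ k) c (sq m) i : ℝ) + (R₀ + R) ≤ (P.L ^ k * M0 i : ℕ) - 1) ∧
          B5Ineq137Torus.T P 0 x₁ (sq m) ≤ B5Ineq137Torus.T P 0 x₁ x₂) →
      ∀ (f : Balaban1983to89.Site P 0 → ℂ) (F D : ℝ), (∀ y, ‖f y‖ ≤ F) → 0 ≤ D →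
        (∀ y, f y ≠ 0 → D ≤ B5Ineq137Torus.T P 0 x₁ y) → (∀ y, f y ≠ 0 → D ≤ B5Ineq137Torus.T P 0 x₂ y) →
        ((P.L : ℝ) ^ k / B5Ineq137Torus.T P 0 x₁ x₂) ^ θ' *
          ‖toC (chainHol sq cb U n) *
              ((gLocT (B1RG242Torus.α P a k * (P.L : ℝ) ^ (k * P.d)) P.eps⁻¹ U k
                  (cubeFam hPd (P.L ^ k) c M0 s W) (lamFam hPd (P.L ^ k) c M0 s) (cutoff R₁ R₀ (B5Ineq137Torus.T P 0)) *ᵥ f) x₂ -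
                (gBox (B1RG242Torus.α P a k * (P.L : ℝ) ^ (k * P.d)) P.eps⁻¹ U k univ *ᵥ f) x₂) -
            ((gLocT (B1RG242Torus.α P a k * (P.L : ℝ) ^ (k * P.d)) P.eps⁻¹ U k
                  (cubeFam hPd (P.L ^ k) c M0 s W) (lamFam hPd (P.L ^ k) c M0 s) (cutoff R₁ R₀ (B5Ineq137Torus.T P 0)) *ᵥ f) x₁ -
                (gBox (B1RG242Torus.α P a k * (P.L : ℝ) ^ (k * P.d)) P.eps⁻¹ U k univ *ᵥ f) x₁)‖ ≤
          P.spacing k ^ 2 * (C * Real.exp (δ₀ / 2) *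
            ((⌊(((P.L : ℝ) ^ k) - 1 + R₀) / s⌋₊ + 3) ^ (d + 1) * (1 + (P.L : ℝ) ^ k * ((R₀ - R₁)⁻¹ + (s : ℝ)⁻¹)) *
              Real.exp (-(δ₀ * (((P.L : ℝ) ^ k)⁻¹ * (2 * R - 1)))) +
            (1 + (P.L : ℝ) ^ k * (R₀ - R₁)⁻¹) * Real.exp (-(δ₀ / 2 * (((P.L : ℝ) ^ k)⁻¹ * (R₁ - 1))))) *
            Real.exp (-(δ₀ / 2 * (((P.L : ℝ) ^ k)⁻¹ * D))) * F) := by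
  obtain ⟨δ₀, c₀, hδ₀, hc₀, HI⟩ := inputs_smallPlaquette_deriv d ℓ hd1 hd3 hℓ hodd ha
  obtain ⟨C, hC, G⟩ := holder231_wholeTorus_of_inputs d hc₀.le
  refine ⟨δ₀, C, hδ₀, hC, ?_⟩
  intro P hPd hPL k hk1 hkK hbig U θ hθ0 hθ hτ c M0 hM0 hfit0 hN0 s W hs R R₀ R₁ hR hR₁ hR10 hW hgap θ' hθ'0 hθ'1
    x₁ x₂ n sq cb hsq0 hsqn hJ hnle hchain f F D hF hD hsupp₁ hsupp₂
  obtain ⟨H1, H2, H3, H4⟩ := HI P hPd hPL k hk1 hkK hbig U θ hθ0 hθ hτ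
  exact G P hPd a k hk1 hkK U δ₀ (14 * (P.L : ℝ) ^ k) hδ₀ (by positivity) H1 H2 H3 H4 c M0 hM0 hfit0 hN0 s W hs R R₀ R₁ hR hR₁ hR10 hW
    hgap θ' hθ'0 hθ'1 x₁ x₂ n sq cb hsq0 hsqn hJ hnle hchain f F D hF hD hsupp₁ hsupp₂

/-- **THE SAME ALONG THE CHART STAIRCASE** ([6] (1.9): *"Γ_{x,x′} denotes a shortest contour connecting the points x, x′"*): for every pair
`x₁, x₂ ∈ Ω₀` at chart depth `≥ R₀ + R` with `|x₁ − x₂|_T ≤ R₀ + R` THERE IS a bond chain of `≤ (d+1)|x₁ − x₂|_T` steps (gen 28's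
`exists_admissible_contour`) along which the bound of `holder231_smallPlaquette_torus` holds for every `θ'` and `f`.
[cite: BalabanImbrieJaffe1988, (2.31) p.263] [cite: Balaban1983RegularityDecay, Theorem p.573 (1.9)] -/
theorem exists_contour_holder231_smallPlaquette_torus (d ℓ : ℕ) (hd1 : 1 ≤ d) (hd3 : d + 1 ≤ 3) (hℓ : 1 ≤ ℓ) (hodd : Odd (ℓ + 1))
    {a : ℝ} (ha : 0 < a) :
    ∃ δ₀ C : ℝ, 0 < δ₀ ∧ 0 < C ∧ ∀ (P : Params) (hPd : P.d = d + 1), P.L = ℓ + 1 →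
      ∀ (k : ℕ), 1 ≤ k → k ≤ P.K → 2 * (P.L ^ k - 1) + 4 < P.sitesPerDir 0 →
      ∀ (U : GaugeField P 0 U1) (θ : ℝ), 0 ≤ θ → (∀ (y : Balaban1983to89.Site P 0) (μ ν : Fin P.d), ‖plaqC U y μ ν - 1‖ ≤ θ) →
        (((P.L : ℝ) ^ k) ^ 2 * θ) ^ 2 ≤ 1 / 500 →
      ∀ (c M0 : Fin (d + 1) → ℕ), (∀ i, 1 ≤ M0 i) →
        (∀ i, c i * P.L ^ k + P.L ^ k * M0 i ≤ P.sitesPerDir 0) → (∀ i, P.L ^ k * M0 i < P.sitesPerDir 0) →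
      ∀ (s W : ℕ), 1 ≤ s → ∀ (R R₀ R₁ : ℝ), 14 * (P.L : ℝ) ^ k + 1 < R → 0 ≤ R₁ → R₁ < R₀ → 2 * (s : ℝ) / 3 + R₀ / 2 + R ≤ W →
        (∀ i, ((P.L ^ k * M0 i : ℕ) : ℝ) + R ≤ P.sitesPerDir 0) →
      ∀ (x₁ x₂ : Balaban1983to89.Site P 0),
        x₁ ∈ (cubeT hPd (P.L ^ k) c fun i => P.L ^ k * M0 i) →
        (∀ i, R₀ + R ≤ (boxCoord hPd (P.L ^ k) c x₁ i : ℝ) ∧ (boxCoord hPd (P.L ^ k) c x₁ i : ℝ) + (R₀ + R) ≤ (P.L ^ k * M0 i : ℕ) - 1) →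
        x₂ ∈ (cubeT hPd (P.L ^ k) c fun i => P.L ^ k * M0 i) →
        (∀ i, R₀ + R ≤ (boxCoord hPd (P.L ^ k) c x₂ i : ℝ) ∧ (boxCoord hPd (P.L ^ k) c x₂ i : ℝ) + (R₀ + R) ≤ (P.L ^ k * M0 i : ℕ) - 1) →
        B5Ineq137Torus.T P 0 x₁ x₂ ≤ R₀ + R →
      ∃ (N : ℕ) (sq : ℕ → Balaban1983to89.Site P 0) (cb : ℕ → PBond P 0), sq 0 = x₁ ∧ sq N = x₂ ∧
        (∀ m < N, Joins (cb m) (sq m) (sq (m + 1))) ∧ (N : ℝ) ≤ ((d : ℝ) + 1) * B5Ineq137Torus.T P 0 x₁ x₂ ∧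
      ∀ (θ' : ℝ), 0 ≤ θ' → θ' ≤ 1 →
      ∀ (f : Balaban1983to89.Site P 0 → ℂ) (F D : ℝ), (∀ y, ‖f y‖ ≤ F) → 0 ≤ D →
        (∀ y, f y ≠ 0 → D ≤ B5Ineq137Torus.T P 0 x₁ y) → (∀ y, f y ≠ 0 → D ≤ B5Ineq137Torus.T P 0 x₂ y) →
        ((P.L : ℝ) ^ k / B5Ineq137Torus.T P 0 x₁ x₂) ^ θ' *
          ‖toC (chainHol sq cb U N) *
              ((gLocT (B1RG242Torus.α P a k * (P.L : ℝ) ^ (k * P.d)) P.eps⁻¹ U k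
                  (cubeFam hPd (P.L ^ k) c M0 s W) (lamFam hPd (P.L ^ k) c M0 s) (cutoff R₁ R₀ (B5Ineq137Torus.T P 0)) *ᵥ f) x₂ -
                (gBox (B1RG242Torus.α P a k * (P.L : ℝ) ^ (k * P.d)) P.eps⁻¹ U k univ *ᵥ f) x₂) -
            ((gLocT (B1RG242Torus.α P a k * (P.L : ℝ) ^ (k * P.d)) P.eps⁻¹ U k
                  (cubeFam hPd (P.L ^ k) c M0 s W) (lamFam hPd (P.L ^ k) c M0 s) (cutoff R₁ R₀ (B5Ineq137Torus.T P 0)) *ᵥ f) x₁ -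
                (gBox (B1RG242Torus.α P a k * (P.L : ℝ) ^ (k * P.d)) P.eps⁻¹ U k univ *ᵥ f) x₁)‖ ≤
          P.spacing k ^ 2 * (C * Real.exp (δ₀ / 2) *
            ((⌊(((P.L : ℝ) ^ k) - 1 + R₀) / s⌋₊ + 3) ^ (d + 1) * (1 + (P.L : ℝ) ^ k * ((R₀ - R₁)⁻¹ + (s : ℝ)⁻¹)) *
              Real.exp (-(δ₀ * (((P.L : ℝ) ^ k)⁻¹ * (2 * R - 1)))) +
            (1 + (P.L : ℝ) ^ k * (R₀ - R₁)⁻¹) * Real.exp (-(δ₀ / 2 * (((P.L : ℝ) ^ k)⁻¹ * (R₁ - 1))))) *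
            Real.exp (-(δ₀ / 2 * (((P.L : ℝ) ^ k)⁻¹ * D))) * F) := by
  obtain ⟨δ₀, c₀, hδ₀, hc₀, HI⟩ := inputs_smallPlaquette_deriv d ℓ hd1 hd3 hℓ hodd ha
  obtain ⟨C, hC, G⟩ := exists_contour_holder231_wholeTorus_of_inputs d hc₀.le
  refine ⟨δ₀, C, hδ₀, hC, ?_⟩
  intro P hPd hPL k hk1 hkK hbig U θ hθ0 hθ hτ c M0 hM0 hfit0 hN0 s W hs R R₀ R₁ hR hR₁ hR10 hW hgap x₁ x₂ hx₁ hdeep₁ hx₂ hdeep₂ hT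
  obtain ⟨H1, H2, H3, H4⟩ := HI P hPd hPL k hk1 hkK hbig U θ hθ0 hθ hτ
  exact G P hPd a k hk1 hkK U δ₀ (14 * (P.L : ℝ) ^ k) hδ₀ (by positivity) H1 H2 H3 H4 c M0 hM0 hfit0 hN0 s W hs R R₀ R₁ hR hR₁ hR10 hW
    hgap x₁ x₂ hx₁ hdeep₁ hx₂ hdeep₂ hT

end

end Literature.MathematicalPhysics.QuantumFieldTheory.BalabanImbrieJaffe1984to88.BIJ88LocDeriv231SmallPlaquetteTorus
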